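import Literature.NumberTheory.LFunctions.ExplicitFormulaPsiOneTrivialZeros
import Mathlib.Analysis.SpecialFunctions.Gamma.Deriv
import HarnessLib

/-!
# The trivial zeros of `ζ` are simple; the remainder of the explicit formula for `ψ₁` explicitly

Topic: `Literature/NumberTheory/LFunctions`. THEOREMS (everything proved). Support file for the
discharge of `Literature.NumberTheory.LFunctions.schoenfeld_explicit` (Schoenfeld 1976, Cor. 1:
under RH `|π(x) − li(x)| < √x log x/(8π)` for `x ≥ 2657`), whose analytic half differences the
explicit formula for `ψ₁` (`Literature.NumberTheory.LFunctions.psiOne_eq_explicit_trivialZeros`):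

  `ψ₁(x) = x²/2 − ∑_ρ m(ρ) x^{ρ+1}/(ρ(ρ+1)) − (log 2π) x + (ζ'/ζ)(−1) − ∑_{k ≥ 1} m(−2k) x^{1−2k}/(2k(2k−1))`.

The tree records the trivial-zero multiplicities only as `m(−2k) ≥ 1`
(`riemannZetaZeroOrder_trivial_pos`). An *upper* bound for the differenced remainder
`E(x+h) − E(x)` (needed for the upper bound of `ψ`) requires their actual value. We prove:

* `deriv_riemannZeta_trivialZero_ne_zero` — `ζ'(−2(k+1)) ≠ 0`: differentiate Riemann's functional
  equation `ζ(1−s) = 2(2π)^{−s} Γ(s) cos(πs/2) ζ(s)` (Mathlib's `riemannZeta_one_sub`) at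
  `s = 2k+3`, where `cos(πs/2)` has a simple zero and the other factors do not vanish
  (Titchmarsh, *The Theory of the Riemann Zeta-Function*, §2.4: "ζ(s) has simple zeros at
  `s = −2, −4, …`");
* `riemannZetaZeroOrder_trivialZero` — hence `m(−2(k+1)) = 1`;
* `hasSum_psiOneRemainder_re`, `re_psiOneRemainder_sub_le` — for `1 < x ≤ y`,
  `0 ≤ Re E(y) − Re E(x) ≤ x/(2(x² − 1))`, where `E = psiOneRemainder` and
  `(ζ'/ζ)(−1) − E(x) = ∑_{k≥0} x^{−(2k+1)}/((2k+2)(2k+1)) ≤ ∑_k x^{−(2k+1)}/2 = x/(2(x²−1))`.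

## References

* E. C. Titchmarsh, *The Theory of the Riemann Zeta-Function*, 2nd ed., OUP 1986, §2.4 (trivial
  zeros are simple), §2.1 (functional equation). [Titchmarsh1986]
* H. L. Montgomery, R. C. Vaughan, *Multiplicative Number Theory I*, CUP 2007, §12.1.1 Exercise 6
  (the remainder of the explicit formula for `ψ₁`). [MontgomeryVaughan2007]
-/

noncomputable section

open Complex Filter Topology
open scoped Real

namespace Literature.NumberTheory.LFunctions

namespace TrivialZerosSimple

/-- For `Re s > 1` the functional equation reads `ζ(1 − s) = F(s) · cos(πs/2)`. [cite: Titchmarsh1986, §2.1] -/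
theorem riemannZeta_one_sub_eq {s : ℂ} (hs : 1 < s.re) :
    riemannZeta (1 - s) =
      ((2 : ℂ) * (2 * (π : ℂ)) ^ (-s) * Complex.Gamma s * riemannZeta s) * Complex.cos (π * s / 2) := by
  have h1 : ∀ n : ℕ, s ≠ -n := by
    intro n hn
    have := congrArg Complex.re hn
    simp at this
    linarith [(n.cast_nonneg : (0 : ℝ) ≤ n)]
  have h2 : s ≠ 1 := by
    intro h; rw [h] at hs; simp at hs
  rw [riemannZeta_one_sub h1 h2]
  ring

/-- `F` is differentiable at every `s` with `Re s > 1`. [folklore] -/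
theorem differentiableAt_fe_factor {s : ℂ} (hs : 1 < s.re) : DifferentiableAt ℂ
      (fun s : ℂ ↦ (2 : ℂ) * (2 * (π : ℂ)) ^ (-s) * Complex.Gamma s * riemannZeta s) s := by
  have h1 : ∀ n : ℕ, s ≠ -n := by
    intro n hn
    have := congrArg Complex.re hn
    simp at this
    linarith [(n.cast_nonneg : (0 : ℝ) ≤ n)]
  have h2 : s ≠ 1 := by
    intro h; rw [h] at hs; simp at hs
  have hcpow : DifferentiableAt ℂ (fun s : ℂ ↦ (2 * π : ℂ) ^ (-s)) s := by
    have : DifferentiableAt ℂ (fun s : ℂ ↦ -s) s := differentiableAt_id.neg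
    exact this.const_cpow (Or.inl (by
      have := Real.pi_pos
      exact_mod_cast (show (2 * π : ℂ) ≠ 0 by exact_mod_cast (by positivity : (2 * π : ℝ) ≠ 0))))
  exact ((differentiableAt_const _).mul hcpow |>.mul (Complex.differentiableAt_Gamma s h1)).mul
    (differentiableAt_riemannZeta h2)

/-- `F(s) ≠ 0` for `Re s > 1` (`ζ(s) ≠ 0` there, `Γ(s) ≠ 0`, `(2π)^{−s} ≠ 0`). [folklore] -/
theorem fe_factor_ne_zero {s : ℂ} (hs : 1 < s.re) :
    ((2 : ℂ) * (2 * (π : ℂ)) ^ (-s) * Complex.Gamma s * riemannZeta s) ≠ 0 := by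
  have h1 : ∀ n : ℕ, s ≠ -n := by
    intro n hn
    have := congrArg Complex.re hn
    simp at this
    linarith [(n.cast_nonneg : (0 : ℝ) ≤ n)]
  have h2pi : (2 * π : ℂ) ≠ 0 := by
    have := Real.pi_pos
    exact_mod_cast (by positivity : (2 * π : ℝ) ≠ 0)
  have hcpow : (2 * π : ℂ) ^ (-s) ≠ 0 := by
    rw [Ne, Complex.cpow_eq_zero_iff]
    exact fun h ↦ h2pi h.1
  exact mul_ne_zero (mul_ne_zero (mul_ne_zero two_ne_zero hcpow) (Complex.Gamma_ne_zero h1))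
    (riemannZeta_ne_zero_of_one_lt_re hs)

/-- `cos(π(2k+3)/2) = 0`. [folklore] -/
theorem cos_half_odd (k : ℕ) : Complex.cos (π * (2 * k + 3) / 2) = 0 := by
  rw [Complex.cos_eq_zero_iff]
  exact ⟨k + 1, by push_cast; ring⟩

/-- `sin(π(2k+3)/2) ≠ 0`. [folklore] -/
theorem sin_half_odd_ne_zero (k : ℕ) : Complex.sin (π * (2 * k + 3) / 2) ≠ 0 := by
  rw [Ne, Complex.sin_eq_zero_iff]
  rintro ⟨n, hn⟩
  have hπ : (π : ℂ) ≠ 0 := by exact_mod_cast Real.pi_ne_zero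
  have h1 : (π : ℂ) * (2 * k + 3) = π * (2 * n) := by linear_combination 2 * hn
  have h2 := mul_left_cancel₀ hπ h1
  have h3 : ((2 * (k : ℤ) + 3 : ℤ) : ℂ) = ((2 * n : ℤ) : ℂ) := by push_cast; exact h2
  have h4 : (2 * (k : ℤ) + 3 : ℤ) = 2 * n := by exact_mod_cast h3
  omega

end TrivialZerosSimple

open TrivialZerosSimple in
/-- **The trivial zeros of `ζ` are simple: `ζ'(−2(k+1)) ≠ 0`** (Titchmarsh §2.4). Differentiate
`ζ(1−s) = F(s) cos(πs/2)` at `s₀ = 2k+3`: the left side gives `−ζ'(1−s₀)`, the right side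
`F(s₀) · (−π/2) sin(πs₀/2) ≠ 0` since `cos(πs₀/2) = 0`. [cite: Titchmarsh1986, §2.4] -/
theorem deriv_riemannZeta_trivialZero_ne_zero (k : ℕ) :
    deriv riemannZeta (-2 * ((k : ℂ) + 1)) ≠ 0 := by
  set s₀ : ℂ := 2 * k + 3 with hs₀
  have hre : 1 < s₀.re := by
    simp [hs₀]
    linarith [(k.cast_nonneg : (0 : ℝ) ≤ k)]
  have h1s : 1 - s₀ = -2 * ((k : ℂ) + 1) := by rw [hs₀]; ring
  -- the left side
  have hζ : HasDerivAt (fun s : ℂ ↦ riemannZeta (1 - s))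
      (deriv riemannZeta (1 - s₀) * (-1)) s₀ := by
    have hd : DifferentiableAt ℂ riemannZeta (1 - s₀) := by
      refine differentiableAt_riemannZeta ?_
      rw [h1s]; intro h
      have := congrArg Complex.re h
      simp at this; linarith [(k.cast_nonneg : (0 : ℝ) ≤ k)]
    have hsub : HasDerivAt (fun s : ℂ ↦ 1 - s) (-1) s₀ := by
      simpa using (hasDerivAt_id s₀).const_sub 1
    exact hd.hasDerivAt.comp s₀ hsub
  -- the right side
  have hcos : HasDerivAt (fun s : ℂ ↦ Complex.cos (π * s / 2))
      (-Complex.sin (π * s₀ / 2) * (π / 2)) s₀ := by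
    have hlin : HasDerivAt (fun s : ℂ ↦ π * s / 2) (π / 2) s₀ := by
      have := ((hasDerivAt_id s₀).const_mul (π : ℂ)).div_const 2
      simpa using this
    exact (Complex.hasDerivAt_cos _).comp s₀ hlin
  have hF := (differentiableAt_fe_factor hre).hasDerivAt
  have hprod := hF.mul hcos
  -- the two sides agree near `s₀`
  have hev : (fun s : ℂ ↦ riemannZeta (1 - s)) =ᶠ[𝓝 s₀]
      fun s ↦ ((2 : ℂ) * (2 * (π : ℂ)) ^ (-s) * Complex.Gamma s * riemannZeta s) * Complex.cos (π * s / 2) := by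
    have hopen : IsOpen {s : ℂ | 1 < s.re} := isOpen_lt continuous_const Complex.continuous_re
    filter_upwards [hopen.mem_nhds hre] with s hs
    exact riemannZeta_one_sub_eq hs
  have hζ' := hprod.congr_of_eventuallyEq hev
  have heq := hζ.unique hζ'
  have hcos0 : Complex.cos (π * s₀ / 2) = 0 := by rw [hs₀]; exact cos_half_odd k
  have hsin0 : Complex.sin (π * s₀ / 2) ≠ 0 := by rw [hs₀]; exact sin_half_odd_ne_zero k
  rw [hcos0, mul_zero, zero_add] at heq
  rw [← h1s]
  intro h0
  rw [h0, zero_mul] at heq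
  have hπ : (π : ℂ) / 2 ≠ 0 := div_ne_zero (by exact_mod_cast Real.pi_ne_zero) two_ne_zero
  have : ((2 : ℂ) * (2 * (π : ℂ)) ^ (-s₀) * Complex.Gamma s₀ * riemannZeta s₀) *
      (-Complex.sin (π * s₀ / 2) * (π / 2)) ≠ 0 :=
    mul_ne_zero (fe_factor_ne_zero hre) (mul_ne_zero (neg_ne_zero.2 hsin0) hπ)
  exact this heq.symm

/-- **`m(−2(k+1)) = 1`**: the trivial zeros of `ζ` are simple (Titchmarsh §2.4).
[cite: Titchmarsh1986, §2.4] -/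
theorem riemannZetaZeroOrder_trivialZero (k : ℕ) :
    riemannZetaZeroOrder (-2 * ((k : ℂ) + 1)) = 1 := by
  have hne1 : (-2 * ((k : ℂ) + 1)) ≠ 1 := by
    intro h
    have := congrArg Complex.re h
    simp at this; linarith [(k.cast_nonneg : (0 : ℝ) ≤ k)]
  have ha : AnalyticAt ℂ riemannZeta (-2 * ((k : ℂ) + 1)) := analyticOn_riemannZeta _ hne1
  have hord : analyticOrderAt riemannZeta (-2 * ((k : ℂ) + 1)) = 1 :=
    ha.analyticOrderAt_eq_one_of_zero_deriv_ne_zero (riemannZeta_neg_two_mul_nat_add_one k)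
      (deriv_riemannZeta_trivialZero_ne_zero k)
  rw [riemannZetaZeroOrder, ha.meromorphicOrderAt_eq, hord]
  rfl

/-! ### The remainder `E(x)` of the explicit formula for `ψ₁`, explicitly -/

/-- **`(ζ'/ζ)(−1) − Re E(x) = ∑_{k ≥ 0} x^{−(2k+1)}/((2k+2)(2k+1))`** for `x > 1`: the real form of
`hasSum_psiOneRemainder_trivialZeros_re` with the multiplicities `m(−2(k+1)) = 1` inserted.
[cite: MontgomeryVaughan2007, §12.1.1 Exercise 6] -/
theorem hasSum_psiOneRemainder_re {x : ℝ} (hx : 1 < x) :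
    HasSum (fun k : ℕ ↦ x ^ (-(2 * (k : ℝ) + 1)) / ((2 * k + 2) * (2 * k + 1)))
      ((deriv riemannZeta (-1) / riemannZeta (-1)).re - (psiOneRemainder x).re) := by
  have h := hasSum_psiOneRemainder_trivialZeros_re hx
  refine h.congr_fun fun k ↦ ?_
  rw [riemannZetaZeroOrder_trivialZero k]
  push_cast
  ring

/-- The geometric majorant: `∑_k x^{−(2k+1)}/2 = x/(2(x² − 1))` for `x > 1`. [folklore] -/
theorem hasSum_rpow_neg_odd_half {x : ℝ} (hx : 1 < x) :
    HasSum (fun k : ℕ ↦ x ^ (-(2 * (k : ℝ) + 1)) / 2) (x / (2 * (x ^ 2 - 1))) := by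
  have hx0 : 0 < x := by linarith
  have hr : x⁻¹ ^ 2 < 1 := by
    rw [inv_pow]
    exact inv_lt_one_of_one_lt₀ (by nlinarith)
  have hr0 : 0 ≤ x⁻¹ ^ 2 := by positivity
  have hg := hasSum_geometric_of_lt_one hr0 hr
  have hg' : HasSum (fun k : ℕ ↦ x⁻¹ / 2 * (x⁻¹ ^ 2) ^ k) (x⁻¹ / 2 * (1 - x⁻¹ ^ 2)⁻¹) :=
    hg.mul_left (x⁻¹ / 2)
  have hx21 : x ^ 2 - 1 ≠ 0 := by nlinarith
  have hterm : ∀ k : ℕ, x ^ (-(2 * (k : ℝ) + 1)) / 2 = x⁻¹ / 2 * (x⁻¹ ^ 2) ^ k := by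
    intro k
    rw [Real.rpow_neg hx0.le, show (2 * (k : ℝ) + 1) = ((2 * k + 1 : ℕ) : ℝ) by push_cast; ring,
      Real.rpow_natCast, ← inv_pow, pow_succ, pow_mul]
    ring
  have hval : x⁻¹ / 2 * (1 - x⁻¹ ^ 2)⁻¹ = x / (2 * (x ^ 2 - 1)) := by
    have hx1 : 1 - x⁻¹ ^ 2 = (x ^ 2 - 1) / x ^ 2 := by field_simp
    rw [hx1, inv_div]
    field_simp
  rw [← hval]
  exact hg'.congr_fun hterm

/-- **`0 ≤ (ζ'/ζ)(−1) − Re E(x) ≤ x/(2(x² − 1))`** for `x > 1`. [cite: MontgomeryVaughan2007, §12.1.1 Exercise 6] -/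
theorem re_const_sub_psiOneRemainder_mem {x : ℝ} (hx : 1 < x) :
    0 ≤ (deriv riemannZeta (-1) / riemannZeta (-1)).re - (psiOneRemainder x).re ∧
      (deriv riemannZeta (-1) / riemannZeta (-1)).re - (psiOneRemainder x).re ≤
        x / (2 * (x ^ 2 - 1)) := by
  have hS := hasSum_psiOneRemainder_re hx
  have hG := hasSum_rpow_neg_odd_half hx
  have hx0 : 0 < x := by linarith
  constructor
  · exact hS.nonneg fun k ↦ by positivity
  · refine hasSum_le (fun k ↦ ?_) hS hG
    apply div_le_div_of_nonneg_left (by positivity) (by norm_num)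
    nlinarith [(k.cast_nonneg : (0 : ℝ) ≤ k)]

/-- **The differenced remainder**: for `1 < x ≤ y`, `0 ≤ Re E(y) − Re E(x) ≤ x/(2(x² − 1))`
(`Re E` is non-decreasing and bounded above by `(ζ'/ζ)(−1)`, which it approaches within
`x/(2(x²−1))`). This is the only place where the simplicity of the trivial zeros enters the
Schoenfeld bound. [cite: MontgomeryVaughan2007, §12.1.1 Exercise 6] -/
theorem re_psiOneRemainder_sub_mem {x y : ℝ} (hx : 1 < x) (hxy : x ≤ y) :
    0 ≤ (psiOneRemainder y).re - (psiOneRemainder x).re ∧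
      (psiOneRemainder y).re - (psiOneRemainder x).re ≤ x / (2 * (x ^ 2 - 1)) := by
  have hy : 1 < y := hx.trans_le hxy
  obtain ⟨hy0, -⟩ := re_const_sub_psiOneRemainder_mem hy
  obtain ⟨-, hx1⟩ := re_const_sub_psiOneRemainder_mem hx
  -- monotonicity: the series at `y` is termwise below the series at `x`
  have hle : ∀ k : ℕ, y ^ (-(2 * (k : ℝ) + 1)) / ((2 * k + 2) * (2 * k + 1)) ≤
      x ^ (-(2 * (k : ℝ) + 1)) / ((2 * k + 2) * (2 * k + 1)) := by
    intro k
    refine div_le_div_of_nonneg_right ?_ (by positivity)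
    exact Real.rpow_le_rpow_of_nonpos (by linarith) hxy
      (by nlinarith [(k.cast_nonneg : (0 : ℝ) ≤ k)])
  have hmono := hasSum_le hle (hasSum_psiOneRemainder_re hy) (hasSum_psiOneRemainder_re hx)
  exact ⟨by linarith, by linarith⟩

end Literature.NumberTheory.LFunctions

end
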